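import Mathlib.Topology.UnitInterval
import Mathlib.Topology.MetricSpace.Bounded
import Mathlib.Topology.UniformSpace.HeineCantor
import Mathlib.MeasureTheory.Measure.Lebesgue.Basic
import HarnessLib

/-!
# Finitely many disjoint sub-arcs of a given diameter (helper for the docked boundary two-arm conservation law)

Crux `LagHandOff` (stmt-CriticalPhenomena-10268), line `hitting-tournament`, seat c4.  Ingredient (2) of the docked
conservation law I0 (Cruxes/LagHandOff/NOTES.md §7): a continuous curve `γ : [0,1] → X` has, for every `η > 0`, a
bound `N` on the number of pairwise disjoint parameter intervals whose images have diameter `≥ η` (uniform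
continuity: each such interval has length `≥ θ`, and disjoint sub-intervals of `[0,1]` have total length `≤ 1`).
-/

noncomputable section

open Set Metric MeasureTheory
open scoped unitInterval

namespace Summit.CriticalPhenomena.CardyFormulaZ2.Cruxes.LagHandOff.HittingTournament

/-- **Finitely many disjoint sub-arcs of diameter `≥ η`.**  For a continuous curve `γ` on `[0,1]` with values in a
pseudo-metric space and `η > 0` there is `N` such that every finite family of pairwise disjoint closed parameter
intervals `[s i, t i] ⊆ [0,1]` whose images under `γ` all have diameter at least `η` has at most `N` members.
[folklore] -/
theorem card_le_of_disjoint_subarcs :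
    ∀ {X : Type*} [PseudoMetricSpace X] (γ : C(I, X)) {η : ℝ}, 0 < η → ∃ N : ℕ, ∀ (ι : Type*) (F : Finset ι) (s t : ι → I), (∀ i ∈ F, s i ≤ t i) → (∀ i ∈ F, ∀ j ∈ F, i ≠ j → Disjoint (Icc (s i : ℝ) (t i)) (Icc (s j : ℝ) (t j))) → (∀ i ∈ F, η ≤ diam (γ '' Icc (s i) (t i))) → F.card ≤ N := by
  intro X _ γ η hη
  -- uniform continuity of `γ` on the compact interval
  have huc : UniformContinuous γ := CompactSpace.uniformContinuous_of_continuous γ.continuous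
  obtain ⟨θ, hθ, hθc⟩ := Metric.uniformContinuous_iff.1 huc (η / 2) (half_pos hη)
  refine ⟨⌊1 / θ⌋₊ + 1, fun ι F s t hst hdisj hdiam => ?_⟩
  classical
  -- each interval has length ≥ θ
  have hlen : ∀ i ∈ F, θ ≤ (t i : ℝ) - s i := by
    intro i hi
    by_contra hlt
    push Not at hlt
    -- any two parameters of the interval are `θ`-close, so the image has diameter `≤ η / 2 < η`
    have hclose : ∀ u ∈ Icc (s i) (t i), ∀ v ∈ Icc (s i) (t i), dist (γ u) (γ v) < η / 2 := by
      intro u hu v hv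
      apply hθc
      rw [Subtype.dist_eq, Real.dist_eq, abs_lt]
      have h1 : (s i : ℝ) ≤ u := hu.1
      have h2 : (u : ℝ) ≤ t i := hu.2
      have h3 : (s i : ℝ) ≤ v := hv.1
      have h4 : (v : ℝ) ≤ t i := hv.2
      constructor <;> linarith
    have hd : diam (γ '' Icc (s i) (t i)) ≤ η / 2 := by
      refine diam_le_of_forall_dist_le (by positivity) ?_
      rintro _ ⟨u, hu, rfl⟩ _ ⟨v, hv, rfl⟩
      exact (hclose u hu v hv).le
    have := (hdiam i hi).trans hd
    linarith
  -- total length of disjoint sub-intervals of `[0,1]` is at most `1`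
  have hsum : ∑ i ∈ F, ((t i : ℝ) - s i) ≤ 1 := by
    have hmeas : ∀ i ∈ F, MeasurableSet (Icc (s i : ℝ) (t i)) := fun i _ => measurableSet_Icc
    have hU : (⋃ i ∈ F, Icc (s i : ℝ) (t i)) ⊆ Icc 0 1 := by
      intro x hx
      simp only [mem_iUnion] at hx
      obtain ⟨i, hi, hx⟩ := hx
      exact ⟨(s i).2.1.trans hx.1, hx.2.trans (t i).2.2⟩
    have h1 : volume (⋃ i ∈ F, Icc (s i : ℝ) (t i)) ≤ volume (Icc (0 : ℝ) 1) := measure_mono hU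
    rw [measure_biUnion_finset (fun i hi j hj hij => hdisj i hi j hj hij) hmeas, Real.volume_Icc, sub_zero,
      ENNReal.ofReal_one] at h1
    have h2 : ∑ i ∈ F, volume (Icc (s i : ℝ) (t i)) = ∑ i ∈ F, ENNReal.ofReal ((t i : ℝ) - s i) := by
      refine Finset.sum_congr rfl fun i hi => ?_
      rw [Real.volume_Icc]
    rw [h2, ← ENNReal.ofReal_sum_of_nonneg (fun i hi => sub_nonneg.2 (Subtype.coe_le_coe.2 (hst i hi)))] at h1
    have := (ENNReal.ofReal_le_one).1 h1
    exact this
  have hcard : (F.card : ℝ) * θ ≤ 1 := by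
    calc (F.card : ℝ) * θ = ∑ i ∈ F, θ := by rw [Finset.sum_const, nsmul_eq_mul]
      _ ≤ ∑ i ∈ F, ((t i : ℝ) - s i) := Finset.sum_le_sum hlen
      _ ≤ 1 := hsum
  have : (F.card : ℝ) ≤ 1 / θ := by
    rw [le_div_iff₀ hθ]; exact hcard
  have : (F.card : ℝ) < ⌊1 / θ⌋₊ + 1 := this.trans_lt (Nat.lt_floor_add_one _)
  exact_mod_cast this.le

end Summit.CriticalPhenomena.CardyFormulaZ2.Cruxes.LagHandOff.HittingTournament

end
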